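import Summits.BirchSwinnertonDyer.BirchSwinnertonDyer.Theorems.AdditiveKolyvaginRoadGammaAvatarLocusSlim
import Summits.BirchSwinnertonDyer.BirchSwinnertonDyer.Theorems.EdixhovenFibreFiveSevenTwistDegreeStepFiveSevenAddvUnitTwist
import Summits.BirchSwinnertonDyer.Rank1Residual.AdditivePotMult.RankOneHeegner
import Summits.BirchSwinnertonDyer.Rank1Residual.X11b.TwistTransportRam
import Literature.NumberTheory.EllipticCurves.Fouquet2025.Assumption34TwistLocusProofs
import Literature.NumberTheory.EllipticCurves.KubertTateNineBadPrimes
import Literature.NumberTheory.EllipticCurves.PAdicHeightsProofs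
import HarnessLib

/-!
# Route `AdditiveKolyvaginRoad`: TRANSPORT OF THE FRAME BINDER ♠(1) (`p ∤ ord_ℓ Δ_min` at the multiplicative primes) AND OF `p ∤ ∏ c_ℓ`
# ALONG A QUADRATIC TWIST THAT CREATES NO NEW MULTIPLICATIVE PRIME — the Tamagawa side condition of the partner twists in the quadratic
# half-descent (`…KolyvaginClassOfQuadraticLowerHalves.lean`, cards `inert-theta-refinement` ∕ `parahoric-ordinary-type-engine` on crux KS′
# `LevelKolyvaginSystemsAdditive`, item stmt-BirchSwinnertonDyer-21396; cell `pub/bsd-wall`, width seat `bsd-wall-akr-p2x-w3` g11; `--supports` 21396, helper)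

THEOREMS ONLY (no definition, no named fact, no `sorry`); elementary reduction-type bookkeeping over tree lemmas.  BSD is not proved by any
of this; KS′ and KPA′ stay OPEN at `p² ∣ N`.

THE POINT.  In the per-frame half-descent `AdditiveKoly.exists_kolyvaginClass_ne_zero_of_quadraticLowerHalves_of_kato` the two rank-`0`
PARTNER twists `W₁` (a minimal model of `E^{(c₁)}`) and `W₂` (of `E^{(d_K)(c₂)}`) carry Kato's Tamagawa binder `p ∤ ∏ c_ℓ(W_i)`.  At `p ≥ 5`,
`p ∣ ∏ c_ℓ(X)` iff `p ∣ ord_v Δ_min(X) = c_v` at some SPLIT multiplicative place of `X` (Kodaira–Néron: `c_v ≤ 4` elsewhere; tree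
`CornerLocal.not_dvd_tamagawaProduct_iff_forall`, packaged as `AdditiveKoly.not_dvd_tamagawaProduct_of_spadeOne`) — so the binder is the
frame's own hypothesis ♠(1) «`p ∤ ord_ℓ(Δ_min)` at every multiplicative `ℓ`» read on `W_i`.  ♠(1) TRANSPORTS from `E` to any curve `X` with the
same `j`-invariant all of whose multiplicative primes are multiplicative for `E` (at a common multiplicative prime `ord_ℓ Δ_min = −ord_ℓ j` on
both sides, Silverman VII.5.1(b)); and a twist by `d` creates no new multiplicative prime as soon as `d` is an `ℓ`-adic unit at every ODD
additive prime `ℓ` of `E` and `E` is good or multiplicative at `2` (a unit twist at an odd prime preserves additivity,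
`AddvUnitTwist.addv_of_model_unit_twist`; a prime of good reduction of `E` is never multiplicative for `X`, `|j|_ℓ ≤ 1 < |j|_ℓ`), or when `d = d_K`
is the Heegner discriminant (`d_K ∈ (ℚ_ℓ^×)²` at every `ℓ ∣ N`).

* §1 `padicValInt_minimalDiscriminantInt_eq_of_j_eq_of_mult`, `not_hasGoodReductionAtPrime_of_j_eq_of_mult` — local bookkeeping;
* §2 `spadeOne_of_j_eq` — ♠(1) passes from `W` to `X` (`j(X) = j(W)`, every multiplicative prime of `X` multiplicative for `W`);
* §3 `mult_of_model_unit_twist_of_mult` — at an odd `ℓ` with `ord_ℓ d = 0`, a multiplicative prime of a model of `W^{(d)}` is multiplicative for `W`;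
  `mult_of_model_heegnerTwist_of_mult` — the same at every prime for the Heegner twist `d = d_K` (Heegner hypothesis);
* §4 `not_dvd_tamagawaProduct_of_model_unit_twist_of_spadeOne` — `p ≥ 5`, ♠(1) for `W`, `E` not additive at `2`, `d` an `ℓ`-adic unit at every
  additive `ℓ` of `E`, `Wd` a globally minimal model of `W^{(d)}` ⟹ `p ∤ ∏ c_ℓ(Wd)` (and ♠(1) for `Wd`);
  `spadeOne_of_model_heegnerTwist`, `not_dvd_tamagawaProduct_of_model_heegnerTwist_of_spadeOne` — the same for the Heegner twist, no
  condition at `2`.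

References: J. H. Silverman, *AEC* VII.5 Prop. 5.1, X.5 Cor. 5.4; *ATAEC* IV.9 Cor. 9.2(d), Table 4.1; Jetchev–Skinner–Wan 2017 §7.4.1 (eq:tamK).
-/

-- D-0017: single-problem summit, so `Summit.BirchSwinnertonDyer.BirchSwinnertonDyer.…` repeats a namespace BY DESIGN.
set_option linter.dupNamespace false
set_option autoImplicit false

noncomputable section

open scoped Classical

open WeierstrassCurve NumberField
  Literature.NumberTheory.EllipticCurves Literature.NumberTheory.EllipticCurves.Rank1Residual
  Summit.BirchSwinnertonDyer.Rank1Residual Summit.BirchSwinnertonDyer.Rank1Residual.Additive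
  Summit.BirchSwinnertonDyer.BirchSwinnertonDyer.Theorems

namespace Summit.BirchSwinnertonDyer.BirchSwinnertonDyer.Theorems.AdditiveKoly.QuadraticDescent

/-! ## §1 Local bookkeeping at one prime `ℓ` for two curves with the same `j` -/

/-- **`ord_ℓ Δ_min(X) = ord_ℓ Δ_min(W)` at a common multiplicative prime of two globally minimal curves with `j(X) = j(W)`**: at a
multiplicative prime `ord_ℓ j = −ord_ℓ Δ_min` (Silverman VII.5.1(b); tree `Fouquet2025.padicValRat_j_of_hasMultiplicativeReductionAtPrime`).
[cite: SilvermanAEC2009, VII.5 Prop. 5.1(b)] -/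
theorem padicValInt_minimalDiscriminantInt_eq_of_j_eq_of_mult (W X : WeierstrassCurve ℚ) [W.IsElliptic] [W.IsGloballyMinimal]
    [X.IsElliptic] [X.IsGloballyMinimal] (hj : X.j = W.j) (ℓ : ℕ) [Fact ℓ.Prime]
    (hW : W.HasMultiplicativeReductionAtPrime ℓ) (hX : X.HasMultiplicativeReductionAtPrime ℓ) :
    padicValInt ℓ X.minimalDiscriminantInt = padicValInt ℓ W.minimalDiscriminantInt := by
  have h₁ := Fouquet2025.padicValRat_j_of_hasMultiplicativeReductionAtPrime X ℓ hX
  have h₂ := Fouquet2025.padicValRat_j_of_hasMultiplicativeReductionAtPrime W ℓ hW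
  rw [hj] at h₁
  have h : (padicValInt ℓ X.minimalDiscriminantInt : ℤ) = (padicValInt ℓ W.minimalDiscriminantInt : ℤ) := by
    linarith
  exact_mod_cast h

/-- **A prime of good reduction of `W` is not multiplicative for any curve `X` with `j(X) = j(W)`**: `|j(W)|_ℓ ≤ 1` at good reduction and
`|j(X)|_ℓ > 1` at multiplicative reduction (Silverman VII.5.1; tree `norm_j_le_one_of_hasGoodReductionAtPrime`,
`one_lt_norm_j_of_hasMultiplicativeReductionAtPrime`). [cite: SilvermanAEC2009, VII.5 Prop. 5.1 and Prop. 5.5] -/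
theorem not_hasGoodReductionAtPrime_of_j_eq_of_mult (W X : WeierstrassCurve ℚ) [W.IsElliptic] [X.IsElliptic] (hj : X.j = W.j)
    (ℓ : ℕ) [Fact ℓ.Prime] (hX : X.HasMultiplicativeReductionAtPrime ℓ) : ¬ W.HasGoodReductionAtPrime ℓ := by
  intro hgood
  have h1 : ‖(W.j : ℚ_[ℓ])‖ ≤ 1 := W.norm_j_le_one_of_hasGoodReductionAtPrime hgood
  have h2 : 1 < ‖(X.j : ℚ_[ℓ])‖ := one_lt_norm_j_of_hasMultiplicativeReductionAtPrime hX
  rw [hj] at h2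
  exact absurd h1 (not_le.mpr h2)

/-! ## §2 ♠(1) passes along `j`-equality when no new multiplicative prime appears -/

/-- **Transport of ♠(1).**  `W`, `X` globally minimal with `j(X) = j(W)`; every multiplicative prime of `X` is multiplicative for `W` (`hnew`);
♠(1) for `W` at `p` («`p ∤ ord_ℓ Δ_min(W)` at every multiplicative `ℓ`»).  Then ♠(1) for `X` at `p`. [cite: SilvermanAEC2009, VII.5 Prop. 5.1(b)] -/
theorem spadeOne_of_j_eq (W X : WeierstrassCurve ℚ) [W.IsElliptic] [W.IsGloballyMinimal] [X.IsElliptic] [X.IsGloballyMinimal]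
    (hj : X.j = W.j) (p : ℕ)
    (hnew : ∀ (ℓ : ℕ) [Fact ℓ.Prime], X.HasMultiplicativeReductionAtPrime ℓ → W.HasMultiplicativeReductionAtPrime ℓ)
    (hsp : ∀ (ℓ : ℕ) [Fact ℓ.Prime], W.HasMultiplicativeReductionAtPrime ℓ → ¬ p ∣ padicValInt ℓ W.minimalDiscriminantInt) :
    ∀ (ℓ : ℕ) [Fact ℓ.Prime], X.HasMultiplicativeReductionAtPrime ℓ → ¬ p ∣ padicValInt ℓ X.minimalDiscriminantInt := by
  intro ℓ _ hX
  have hW := hnew ℓ hX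
  rw [padicValInt_minimalDiscriminantInt_eq_of_j_eq_of_mult W X hj ℓ hW hX]
  exact hsp ℓ hW

/-! ## §3 A twist creates no new multiplicative prime: unit twists at odd primes, the Heegner twist -/

/-- **At an ODD prime `ℓ` at which `d` is an `ℓ`-adic unit, a multiplicative prime of a model `Wd` of `W^{(d)}` is multiplicative for `W`.**
`W` is not good at `ℓ` (`j(Wd) = j(W)`, §1) and not additive at `ℓ` (a unit twist at an odd prime preserves additivity,
`AddvUnitTwist.addv_of_model_unit_twist`, and `Wd` is multiplicative), hence multiplicative (trichotomy).
[cite: SilvermanAEC2009, VII.5 Prop. 5.1 and X.5 Cor. 5.4] -/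
theorem mult_of_model_unit_twist_of_mult (W : WeierstrassCurve ℚ) [W.IsElliptic] {d : ℚ} (hd : d ≠ 0)
    (Wd : WeierstrassCurve ℚ) [Wd.IsElliptic] (hWd : ∃ C : VariableChange ℚ, C • W.quadraticTwist d = Wd)
    (ℓ : ℕ) [Fact ℓ.Prime] (hℓ2 : ℓ ≠ 2) (hdu : padicValRat ℓ d = 0) (hm : Wd.HasMultiplicativeReductionAtPrime ℓ) :
    W.HasMultiplicativeReductionAtPrime ℓ := by
  have hj : Wd.j = W.j := AdditivePotMult.j_of_model_twist (W := W) hd hWd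
  have hng : ¬ W.HasGoodReductionAtPrime ℓ := not_hasGoodReductionAtPrime_of_j_eq_of_mult W Wd hj ℓ hm
  by_contra hnm
  have haddd : Addv Wd ℓ := AddvUnitTwist.addv_of_model_unit_twist hℓ2 hd hdu ⟨hng, hnm⟩ hWd
  exact haddd.2 hm

/-- **Every multiplicative prime of a model of the HEEGNER twist `E^{(d_K)}` is multiplicative for `E`** (`K` imaginary quadratic satisfying the
Heegner hypothesis for the conductor of the globally minimal `W`): such a prime `ℓ` is bad for `W` (§1), so `ℓ ∣ N` splits in `K`, `d_K` is an
`ℓ`-adic square (`X11b.isSquare_discr_padic_of_heegner`) and the reduction types of `W` and `Wd` at `ℓ` agree (`AdditivePotMult.addv_iff_of_twist`).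
[cite: SilvermanAEC2009, VII.5 Prop. 5.1 and X.5 Cor. 5.4] [cite: JetchevSkinnerWan2017, §7.4.1 (eq:tamK)] -/
theorem mult_of_model_heegnerTwist_of_mult (W : WeierstrassCurve ℚ) [W.IsElliptic] [W.IsGloballyMinimal]
    (K : Type) [Field K] [NumberField K] (hK : IsImaginaryQuadratic K) (hH : SatisfiesHeegnerHypothesis (W.conductorNorm ℤ) K)
    (Wd : WeierstrassCurve ℚ) [Wd.IsElliptic] (Cd : VariableChange ℚ) (hWd : Cd • W.quadraticTwist (NumberField.discr K : ℚ) = Wd)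
    (ℓ : ℕ) [Fact ℓ.Prime] (hm : Wd.HasMultiplicativeReductionAtPrime ℓ) : W.HasMultiplicativeReductionAtPrime ℓ := by
  have hD0 : (NumberField.discr K : ℚ) ≠ 0 := by exact_mod_cast NumberField.discr_ne_zero K
  have hj : Wd.j = W.j := AdditivePotMult.j_of_model_twist (W := W) hD0 ⟨Cd, hWd⟩
  have hng : ¬ W.HasGoodReductionAtPrime ℓ := not_hasGoodReductionAtPrime_of_j_eq_of_mult W Wd hj ℓ hm
  have hℓN : ℓ ∣ W.conductorNorm ℤ := (W.dvd_conductorNorm_iff_not_hasGoodReductionAtPrime ℓ).mpr hng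
  have hsq' : IsSquare (algebraMap ℚ ℚ_[ℓ] (NumberField.discr K : ℚ)) := X11b.isSquare_discr_padic_of_heegner K hK hH ℓ hℓN
  have hsq : IsSquare (((NumberField.discr K : ℚ) : ℚ) : ℚ_[ℓ]) := by simpa using hsq'
  by_contra hnm
  have haddd : Addv Wd ℓ := (AdditivePotMult.addv_iff_of_twist (W := W) hD0 hsq Wd hWd).mpr ⟨hng, hnm⟩
  exact haddd.2 hm

/-! ## §4 `p ∤ ∏ c_ℓ` for the twists, from ♠(1) on `E` -/

/-- **♠(1) for a model of a twist `W^{(d)}` by a `d` that is a unit at the odd additive primes of `W`, when `W` is not additive at `2`.**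
`W` globally minimal with ♠(1) at `p`; `d ≠ 0` with `ord_ℓ d = 0` at every additive prime `ℓ` of `W`; `W` good or multiplicative at `2`;
`Wd` a globally minimal model of `W^{(d)}`.  Then every multiplicative prime of `Wd` is multiplicative for `W` (§3 at odd `ℓ`; at an even
or non-additive prime `W` is good — excluded by §1 — or multiplicative), so §2 applies. [cite: SilvermanAEC2009, VII.5 Prop. 5.1 and X.5 Cor. 5.4] -/
theorem spadeOne_of_model_unit_twist (W : WeierstrassCurve ℚ) [W.IsElliptic] [W.IsGloballyMinimal] (p : ℕ)
    (hsp : ∀ (ℓ : ℕ) [Fact ℓ.Prime], W.HasMultiplicativeReductionAtPrime ℓ → ¬ p ∣ padicValInt ℓ W.minimalDiscriminantInt)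
    (h2 : W.HasGoodReductionAtPrime 2 ∨ W.HasMultiplicativeReductionAtPrime 2)
    {d : ℚ} (hd : d ≠ 0) (hdu : ∀ (ℓ : ℕ) [Fact ℓ.Prime], Addv W ℓ → padicValRat ℓ d = 0)
    (Wd : WeierstrassCurve ℚ) [Wd.IsElliptic] [Wd.IsGloballyMinimal] (hWd : ∃ C : VariableChange ℚ, C • W.quadraticTwist d = Wd) :
    ∀ (ℓ : ℕ) [Fact ℓ.Prime], Wd.HasMultiplicativeReductionAtPrime ℓ → ¬ p ∣ padicValInt ℓ Wd.minimalDiscriminantInt := by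
  have hj : Wd.j = W.j := AdditivePotMult.j_of_model_twist (W := W) hd hWd
  refine spadeOne_of_j_eq W Wd hj p (fun ℓ _ hm ↦ ?_) hsp
  have hng : ¬ W.HasGoodReductionAtPrime ℓ := not_hasGoodReductionAtPrime_of_j_eq_of_mult W Wd hj ℓ hm
  by_contra hnm
  have hadd : Addv W ℓ := ⟨hng, hnm⟩
  by_cases hℓ2 : ℓ = 2
  · subst hℓ2
    haveI : Fact (Nat.Prime 2) := ⟨Nat.prime_two⟩
    rcases h2 with hg | hmu
    · exact hng (by convert hg)
    · exact hnm (by convert hmu)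
  · exact hnm (mult_of_model_unit_twist_of_mult W hd Wd hWd ℓ hℓ2 (hdu ℓ hadd) hm)

/-- **`p ∤ ∏ c_ℓ(Wd)` for a globally minimal model `Wd` of `W^{(d)}` at `p ≥ 5`**, from ♠(1) for `W`, `W` not additive at `2`, and `d` a unit at
the additive primes of `W` — the Tamagawa binder `htam₁` of `exists_kolyvaginClass_ne_zero_of_quadraticLowerHalves_of_kato` for the partner
`W₁ = Wd` from the frame's ♠(1) (for the card `inert-theta-refinement`: `d = d_F` with the additive primes `≠ p` split in `F` and `p` inert —
all units). [cite: SilvermanATAEC1994, Cor. IV.9.2 (d) and Table 4.1] [cite: SilvermanAEC2009, VII.5 Prop. 5.1] -/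
theorem not_dvd_tamagawaProduct_of_model_unit_twist_of_spadeOne (W : WeierstrassCurve ℚ) [W.IsElliptic] [W.IsGloballyMinimal]
    (p : ℕ) [Fact p.Prime] (hp5 : 5 ≤ p)
    (hsp : ∀ (ℓ : ℕ) [Fact ℓ.Prime], W.HasMultiplicativeReductionAtPrime ℓ → ¬ p ∣ padicValInt ℓ W.minimalDiscriminantInt)
    (h2 : W.HasGoodReductionAtPrime 2 ∨ W.HasMultiplicativeReductionAtPrime 2)
    {d : ℚ} (hd : d ≠ 0) (hdu : ∀ (ℓ : ℕ) [Fact ℓ.Prime], Addv W ℓ → padicValRat ℓ d = 0)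
    (Wd : WeierstrassCurve ℚ) [Wd.IsElliptic] [Wd.IsGloballyMinimal] (hWd : ∃ C : VariableChange ℚ, C • W.quadraticTwist d = Wd) :
    ¬ p ∣ Wd.tamagawaProduct :=
  not_dvd_tamagawaProduct_of_spadeOne Wd p hp5 (spadeOne_of_model_unit_twist W p hsp h2 hd hdu Wd hWd)

/-- **♠(1) for every model of the HEEGNER twist `E^{(d_K)}`** from ♠(1) for `E` (Heegner hypothesis; no condition at `2`).
[cite: SilvermanAEC2009, VII.5 Prop. 5.1] [cite: JetchevSkinnerWan2017, §7.4.1 (eq:tamK)] -/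
theorem spadeOne_of_model_heegnerTwist (W : WeierstrassCurve ℚ) [W.IsElliptic] [W.IsGloballyMinimal] (p : ℕ)
    (hsp : ∀ (ℓ : ℕ) [Fact ℓ.Prime], W.HasMultiplicativeReductionAtPrime ℓ → ¬ p ∣ padicValInt ℓ W.minimalDiscriminantInt)
    (K : Type) [Field K] [NumberField K] (hK : IsImaginaryQuadratic K) (hH : SatisfiesHeegnerHypothesis (W.conductorNorm ℤ) K)
    (Wd : WeierstrassCurve ℚ) [Wd.IsElliptic] [Wd.IsGloballyMinimal] (Cd : VariableChange ℚ)
    (hWd : Cd • W.quadraticTwist (NumberField.discr K : ℚ) = Wd) :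
    ∀ (ℓ : ℕ) [Fact ℓ.Prime], Wd.HasMultiplicativeReductionAtPrime ℓ → ¬ p ∣ padicValInt ℓ Wd.minimalDiscriminantInt := by
  have hD0 : (NumberField.discr K : ℚ) ≠ 0 := by exact_mod_cast NumberField.discr_ne_zero K
  have hj : Wd.j = W.j := AdditivePotMult.j_of_model_twist (W := W) hD0 ⟨Cd, hWd⟩
  exact spadeOne_of_j_eq W Wd hj p (fun ℓ _ hm ↦ mult_of_model_heegnerTwist_of_mult W K hK hH Wd Cd hWd ℓ hm) hsp

/-- **`p ∤ ∏ c_ℓ` for every globally minimal model of the Heegner twist `E^{(d_K)}` at `p ≥ 5`**, from ♠(1) for `E` (the tree's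
`X11b.padicValNat_tamagawaProduct_twist_of_heegner` gives the finer `ord_p`-equality from `p ∤ ∏ c_ℓ(E)`; this is the ♠(1)-reading used by
the partner packages). [cite: SilvermanATAEC1994, Cor. IV.9.2 (d)] [cite: JetchevSkinnerWan2017, §7.4.1 (eq:tamK)] -/
theorem not_dvd_tamagawaProduct_of_model_heegnerTwist_of_spadeOne (W : WeierstrassCurve ℚ) [W.IsElliptic] [W.IsGloballyMinimal]
    (p : ℕ) [Fact p.Prime] (hp5 : 5 ≤ p)
    (hsp : ∀ (ℓ : ℕ) [Fact ℓ.Prime], W.HasMultiplicativeReductionAtPrime ℓ → ¬ p ∣ padicValInt ℓ W.minimalDiscriminantInt)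
    (K : Type) [Field K] [NumberField K] (hK : IsImaginaryQuadratic K) (hH : SatisfiesHeegnerHypothesis (W.conductorNorm ℤ) K)
    (Wd : WeierstrassCurve ℚ) [Wd.IsElliptic] [Wd.IsGloballyMinimal] (Cd : VariableChange ℚ)
    (hWd : Cd • W.quadraticTwist (NumberField.discr K : ℚ) = Wd) : ¬ p ∣ Wd.tamagawaProduct :=
  not_dvd_tamagawaProduct_of_spadeOne Wd p hp5 (spadeOne_of_model_heegnerTwist W p hsp K hK hH Wd Cd hWd)

end Summit.BirchSwinnertonDyer.BirchSwinnertonDyer.Theorems.AdditiveKoly.QuadraticDescent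

end
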